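import Summits.QuantumFields.BalabanUV.T4Continuum.Support.B13Carriers
import Literature.MathematicalPhysics.QuantumFieldTheory.Balaban1983to89.TreeLengthTorusGeometry

/-!
# NE5 ∕ node U3, row O1-a follower — `B13CarriersTranslation`: the TORUS TRANSLATIONS acting on the localization domains of the
# two-run carriers of record `B13Carriers.TwoRuns.carriers`, the INVARIANCE of the tree length `d_j` under them, and an ANCHOR cube per
# domain (so that «label − anchor(X)» is a well-defined, injective, `d`-preserving re-coding — the request of row O1-d1, journal l.5621)

Cell `pub-balaban`, T⁴ sub-cell, NE5 formalisation swarm seat `b2b-balaban-t4-ne5-formalise-leaf-05` (holder of row O1-a CARRIERS;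
instance of record `Support/B13Carriers.lean` p207668 ADOPTED, journal l.5870).  Summits-side NEW WORK under the LEAN PLACEMENT RULE:
finite torus geometry only — no analytic object of Bałaban's construction occurs, no estimate of the manuscripts is used or asserted;
nothing of `B13Carriers` ∕ `TreeLengthTorus*` is edited (imported BY NAME).  HONEST FRAMING (T4-DAG p. 1): rung (B)+1 on a FIXED
finite torus T⁴ — NOT infinite volume, NOT a mass gap, NOT the Clay problem; NE5 NOT PROVED; spine 0∕9.  HONEST DEPENDENCY (cell
line, verbatim): continuum YM on T⁴ ⇐ BetaPertH ∧ nine spine estimates (0/9 proved); BetaPertH ⇐ (D1) ∧ (D4) ∧ CAP+tail; G-an2-4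
gates asym, D1 and NE2/3/4.

WHY (journal l.5621, row O1-d1 «THE TERMWISE BUDGET IS X-BLIND ⇒ TERM LABELS MUST BE ANCHORED»): the termwise interface
`T4InputCauchyRateTermwise.TermBound ∕ TermBudget` weights a term label by an `X`-independent `a k i`; for a budget UNIFORM in the
volume the label of a term of `E^{(k+1)}(X)` must be its SHAPE relative to `X` — the tuple of domains translated so that an anchor
cube of `X` sits at the origin of the torus `π_k` ([Balaban1987RG1] p. 251: the torus *"obtained by the usual identification of
boundary points of the cube"* is homogeneous; p. 263: *"the action (1.3) is invariant with respect to the transformations of the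
lattice T^{(k)}"* — Euclidean lattice symmetry, quoted as the TYPE of the objects below, not used as a fact).  Row O1-d1's
`B13StepTermLabels.Coding` turns such an anchored re-coding into a `TermRep`-preserving relabelling; it needs from the carriers exactly:
a translation action on domains that is injective and preserves the decay length `d`, and an anchor cube per domain.  Supplied here.

WHAT IS PROVED (kernel-checked; Mathlib + the imported tree modules only).
* §1 TRANSLATIONS OF THE CUBE TORUS `TPt d N = (ℤ/N)^d` (an additive group): the covering projection is additive (`proj_add`), wall
  adjacency and face-connectedness are translation invariant (`tadj_add_iff`, `tFaceConnected_image_add`).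
* §2 **`torusTreeLen_image_add`: THE LINEAR SIZE d_j IS TRANSLATION INVARIANT ON THE TORUS** — an admissible graph for `X̄` in the
  universal cover, translated by an integer lift of `v`, is admissible for `X̄ + v` with the same length (`tAdmissible_image_add`, the
  tree's `transSeg` ∕ `len_map_transSeg` ∕ `add_mem_cube`), so the two length sets coincide (`tlengths_image_add`).
* §3 ON THE DOMAINS: `TDom.translate v Y` (a localization domain again), injective in `Y`, `torusTreeLen`-preserving; on the carriers of
  record `Dom.translate X v : R.carriers.Dom` (same scale, `R.carriers.d` preserved, injective on each fibre); the ANCHOR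
  `Dom.anchor X ∈ X.2.1` (a chosen cube of the footprint) and the RECENTRED domain `Dom.recentre X` (translate by `−anchor`), which
  contains the origin cube and has the same scale and decay length — the shape of `X`.
0 sorry; axioms ⊆ {propext, Classical.choice, Quot.sound}.
-/

noncomputable section

namespace Summit.QuantumFields.BalabanUV.T4Continuum.B13CarriersTranslation

open Literature.MathematicalPhysics.QuantumFieldTheory.Balaban1983to89
open Literature.MathematicalPhysics.QuantumFieldTheory.Balaban1983to89.B13ScaleTransfer (Pt)
open Literature.MathematicalPhysics.QuantumFieldTheory.Balaban1983to89.TreeLength (RPt Seg corner cube carrier len)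
open Literature.MathematicalPhysics.QuantumFieldTheory.Balaban1983to89.TreeLengthTorus
open Literature.MathematicalPhysics.QuantumFieldTheory.Balaban1983to89.TreeLengthTorusGeometry
  (transSeg carrier_map_transSeg len_map_transSeg add_mem_cube)
open Summit.QuantumFields.BalabanUV.T4Continuum.B13Carriers (TwoRuns)

variable {d N : ℕ}

/-! ## §1 Translations of the cube torus `(ℤ/N)^d` -/

/-- The covering projection `ℤ^d → (ℤ/N)^d` is additive. [folklore] -/
theorem proj_add (x y : Pt d) : proj N (x + y) = proj N x + proj N y := by
  funext i
  simp [proj, Int.cast_add]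

/-- Incrementing one coordinate commutes with a translation. [folklore] -/
theorem update_add_one_add (a v : TPt d N) (i : Fin d) :
    Function.update (a + v) i ((a + v) i + 1) = Function.update a i (a i + 1) + v := by
  funext l
  by_cases h : l = i
  · subst h; simp [add_right_comm]
  · simp [Function.update_of_ne h]

/-- WALL ADJACENCY IS TRANSLATION INVARIANT on the torus. [folklore] -/
theorem tadj_add_iff (a b v : TPt d N) : TAdj (a + v) (b + v) ↔ TAdj a b := by
  unfold TAdj
  refine exists_congr fun i => ?_
  rw [update_add_one_add a v i, update_add_one_add b v i]
  constructor
  · rintro (h | h)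
    · exact Or.inl (add_right_cancel h)
    · exact Or.inr (add_right_cancel h)
  · rintro (h | h)
    · exact Or.inl (by rw [h])
    · exact Or.inr (by rw [h])

/-- A translated family: the image under `· + v` (an injective map, so a `Finset.map` along `Equiv.addRight`). [folklore] -/
theorem image_add_eq_map (S : Finset (TPt d N)) (v : TPt d N) :
    S.image (· + v) = S.map (Equiv.addRight v).toEmbedding := by
  rw [Finset.map_eq_image]
  rfl

/-- Membership in a translated family. [folklore] -/
theorem mem_image_add_iff {S : Finset (TPt d N)} {v a : TPt d N} : a ∈ S.image (· + v) ↔ a - v ∈ S := by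
  rw [Finset.mem_image]
  constructor
  · rintro ⟨b, hb, rfl⟩
    simpa using hb
  · intro h
    exact ⟨a - v, h, sub_add_cancel a v⟩

/-- Translating twice by opposite vectors is the identity on families. [folklore] -/
theorem image_add_image_neg (S : Finset (TPt d N)) (v : TPt d N) : (S.image (· + v)).image (· + -v) = S := by
  rw [Finset.image_image]
  convert Finset.image_id (s := S) using 2
  funext a
  simp

/-- Linkedness inside a family transports along a translation. [folklore] -/
theorem tLinked_image_add {S : Finset (TPt d N)} {x y : TPt d N} (h : TLinked S x y) (v : TPt d N) :
    TLinked (S.image (· + v)) (x + v) (y + v) := by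
  induction h with
  | refl => exact Relation.ReflTransGen.refl
  | tail _ hbc ih =>
    refine ih.tail ⟨?_, ?_, (tadj_add_iff _ _ v).2 hbc.2.2⟩
    · exact Finset.mem_image_of_mem _ hbc.1
    · exact Finset.mem_image_of_mem _ hbc.2.1

/-- FACE-CONNECTEDNESS IS TRANSLATION INVARIANT ([Balaban1987RG1] p. 257: *"two consecutive cubes have a common wall"* — a
translation-invariant notion on the homogeneous torus of p. 251). [folklore] -/
theorem tFaceConnected_image_add {S : Finset (TPt d N)} (h : TFaceConnected S) (v : TPt d N) :
    TFaceConnected (S.image (· + v)) := by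
  intro x hx y hy
  obtain ⟨a, ha, rfl⟩ := Finset.mem_image.1 hx
  obtain ⟨b, hb, rfl⟩ := Finset.mem_image.1 hy
  exact tLinked_image_add (h a ha b hb) v

/-! ## §2 The tree length `d_j` is translation invariant on the torus -/

/-- An admissible graph for `X̄` (torus sense, in the universal cover), translated by an INTEGER vector `k`, is admissible for the
translated family `X̄ + proj k` (the tree's `transSeg`; compare the deck case `TreeLengthTorusGeometry.tAdmissible_translate`, which is
`k ∈ Nℤ^d`). [cite: Balaban1987RG1, p.257 (linear size d_j)] -/
theorem tAdmissible_image_add {X : Finset (TPt d N)} {T : List (Seg d)} (hT : TAdmissible X T) (k : Pt d) :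
    TAdmissible (X.image (· + proj N k)) (T.map (transSeg (corner k))) := by
  have hc : Continuous fun z : RPt d => corner k + z := continuous_const.add continuous_id
  refine ⟨?_, ?_, ?_⟩
  · rw [carrier_map_transSeg]
    exact hT.connected.image _ hc.continuousOn
  · rw [carrier_map_transSeg]
    rintro _ ⟨z, hz, rfl⟩
    obtain ⟨x, hx, hzx⟩ := mem_liftCubes.1 (hT.subset hz)
    refine mem_liftCubes.2 ⟨k + x, ?_, add_mem_cube hzx⟩
    rw [proj_add, add_comm]
    exact Finset.mem_image_of_mem _ hx
  · intro a ha
    obtain ⟨b, hb, rfl⟩ := Finset.mem_image.1 ha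
    obtain ⟨x, hxb, q, hqT, hqx⟩ := hT.meets b hb
    refine ⟨k + x, ?_, corner k + q, ?_, add_mem_cube hqx⟩
    · rw [proj_add, hxb, add_comm]
    · rw [carrier_map_transSeg]
      exact Set.mem_image_of_mem _ hqT

/-- The admissible lengths of `X̄` are admissible lengths of every translate `X̄ + v`. [folklore] -/
theorem tlengths_subset_image_add [NeZero N] (X : Finset (TPt d N)) (v : TPt d N) : tlengths X ⊆ tlengths (X.image (· + v)) := by
  rintro ℓ ⟨T, hT, rfl⟩
  refine ⟨T.map (transSeg (corner (natLift v))), ?_, len_map_transSeg _ _⟩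
  have h := tAdmissible_image_add hT (natLift v)
  rwa [proj_natLift] at h

/-- THE ADMISSIBLE LENGTH SETS OF A FAMILY AND OF ITS TRANSLATES COINCIDE. [folklore] -/
theorem tlengths_image_add [NeZero N] (X : Finset (TPt d N)) (v : TPt d N) : tlengths (X.image (· + v)) = tlengths X := by
  refine Set.Subset.antisymm ?_ (tlengths_subset_image_add X v)
  have h := tlengths_subset_image_add (X.image (· + v)) (-v)
  rwa [image_add_image_neg] at h

/-- **THE LINEAR SIZE d_j(X̄) IS INVARIANT UNDER THE TRANSLATIONS OF THE TORUS** ([Balaban1987RG1] p. 257 definition of d_j on the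
homogeneous torus of p. 251; the tree's `torusTreeLen`). [cite: Balaban1987RG1, p.257 (linear size d_j)] -/
theorem torusTreeLen_image_add [NeZero N] (X : Finset (TPt d N)) (v : TPt d N) :
    torusTreeLen (X.image (· + v)) = torusTreeLen X := by
  unfold torusTreeLen
  rw [tlengths_image_add]

/-! ## §3 Translations of localization domains, of the carriers' domain index; anchors and recentred shapes -/

namespace TDom

variable [NeZero N]

/-- THE TRANSLATE OF A LOCALIZATION DOMAIN by a vector of the cube torus: again non-empty and face-connected. [folklore] -/
def translate (v : TPt d N) (Y : TDom d N) : TDom d N :=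
  ⟨Y.1.image (· + v), Y.2.1.image _, tFaceConnected_image_add Y.2.2 v⟩

/-- The cube family of a translate (definitional). [folklore] -/
@[simp] theorem translate_val (v : TPt d N) (Y : TDom d N) : (translate v Y).1 = Y.1.image (· + v) := rfl

/-- Membership in a translate. [folklore] -/
theorem mem_translate_iff {v a : TPt d N} {Y : TDom d N} : a ∈ (translate v Y).1 ↔ a - v ∈ Y.1 := mem_image_add_iff

/-- Translating by `v` then by `−v` is the identity. [folklore] -/
theorem translate_neg_translate (v : TPt d N) (Y : TDom d N) : translate (-v) (translate v Y) = Y :=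
  Subtype.ext (image_add_image_neg Y.1 v)

/-- Translating by `−v` then by `v` is the identity. [folklore] -/
theorem translate_translate_neg (v : TPt d N) (Y : TDom d N) : translate v (translate (-v) Y) = Y := by
  simpa using translate_neg_translate (-v) Y

/-- Translation by a fixed vector is injective on localization domains. [folklore] -/
theorem translate_injective (v : TPt d N) : Function.Injective (translate v : TDom d N → TDom d N) :=
  fun Y Y' h => by simpa [translate_neg_translate] using congrArg (translate (-v)) h

/-- The tree length of a translate is the tree length. [cite: Balaban1987RG1, p.257 (linear size d_j)] -/
theorem torusTreeLen_translate (v : TPt d N) (Y : TDom d N) : torusTreeLen (translate v Y).1 = torusTreeLen Y.1 :=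
  torusTreeLen_image_add Y.1 v

/-- The translate has as many cubes as the domain. [folklore] -/
theorem card_translate (v : TPt d N) (Y : TDom d N) : (translate v Y).1.card = Y.1.card := by
  rw [translate_val, image_add_eq_map, Finset.card_map]

end TDom

namespace Dom

variable {G : Type} [GaugeGroup G] {R : TwoRuns G}

/-- THE TRANSLATE OF A DOMAIN INDEX of the carriers of record: same creation step, cube family translated on the torus `π_{scale X}`.
[folklore] -/
def translate (X : R.carriers.Dom) (v : TPt 4 (R.cubesPerDir X.1)) : R.carriers.Dom := ⟨X.1, TDom.translate v X.2⟩

/-- A translate has the same creation step (definitional). [folklore] -/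
@[simp] theorem scale_translate (X : R.carriers.Dom) (v : TPt 4 (R.cubesPerDir X.1)) :
    R.carriers.scale (translate X v) = R.carriers.scale X := rfl

/-- The cube family of a translate (definitional). [folklore] -/
@[simp] theorem translate_snd_val (X : R.carriers.Dom) (v : TPt 4 (R.cubesPerDir X.1)) :
    (translate X v).2.1 = X.2.1.image (· + v) := rfl

/-- A translate has the same decay length `d` (translation invariance of `torusTreeLen`). [cite: Balaban1987RG1, p.257 (linear size d_j)] -/
@[simp] theorem d_translate (X : R.carriers.Dom) (v : TPt 4 (R.cubesPerDir X.1)) :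
    R.carriers.d (translate X v) = R.carriers.d X :=
  TDom.torusTreeLen_translate v X.2

/-- Translation by a fixed vector is injective on each fibre `𝐃_j` of the carriers. [folklore] -/
theorem translate_mkDom_injective (j : ℕ) (v : TPt 4 (R.cubesPerDir j)) :
    Function.Injective fun Y : TDom 4 (R.cubesPerDir j) => translate (R.mkDom j Y) v := by
  intro Y Y' h
  have h' : (⟨j, TDom.translate v Y⟩ : Σ i : ℕ, TDom 4 (R.cubesPerDir i)) = ⟨j, TDom.translate v Y'⟩ := h
  exact TDom.translate_injective v (eq_of_heq (Sigma.mk.inj_iff.1 h').2)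

/-- AN ANCHOR CUBE of a domain: a chosen cube of its (non-empty) footprint. [folklore] -/
def anchor (X : R.carriers.Dom) : TPt 4 (R.cubesPerDir X.1) := X.2.2.1.choose

/-- The anchor lies in the footprint. [folklore] -/
theorem anchor_mem (X : R.carriers.Dom) : anchor X ∈ X.2.1 := X.2.2.1.choose_spec

/-- THE RECENTRED DOMAIN («label − anchor»): the translate by `−anchor X` — the SHAPE of `X`, a domain of the same scale containing
the origin cube of `π_{scale X}`. [folklore] -/
def recentre (X : R.carriers.Dom) : R.carriers.Dom := translate X (-anchor X)

/-- The recentred domain has the same creation step (definitional). [folklore] -/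
@[simp] theorem scale_recentre (X : R.carriers.Dom) : R.carriers.scale (recentre X) = R.carriers.scale X := rfl

/-- The recentred domain has the same decay length. [folklore] -/
@[simp] theorem d_recentre (X : R.carriers.Dom) : R.carriers.d (recentre X) = R.carriers.d X := d_translate X _

/-- The recentred domain contains the origin cube. [folklore] -/
theorem zero_mem_recentre (X : R.carriers.Dom) : (0 : TPt 4 (R.cubesPerDir X.1)) ∈ (recentre X).2.1 := by
  show (0 : TPt 4 (R.cubesPerDir X.1)) ∈ X.2.1.image (· + -anchor X)
  exact Finset.mem_image.2 ⟨anchor X, anchor_mem X, add_neg_cancel (anchor X)⟩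

/-- The recentred domain has as many cubes as `X`. [folklore] -/
theorem card_recentre (X : R.carriers.Dom) : (recentre X).2.1.card = X.2.1.card := TDom.card_translate _ X.2

/-- `X` is recovered from its shape and its anchor: translating the recentred domain back by the anchor gives `X` (so «(shape,
anchor)» is a faithful code of a domain of a given scale). [folklore] -/
theorem translate_recentre_anchor (X : R.carriers.Dom) :
    TDom.translate (anchor X) (recentre X).2 = X.2 :=
  TDom.translate_translate_neg (anchor X) X.2

end Dom

end Summit.QuantumFields.BalabanUV.T4Continuum.B13CarriersTranslation

end
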